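import Summits.HodgeConjecture.HodgeConjecture.Theorems.CurveNetMordellWeilVerticalSupportMiddleReduction
import Literature.AlgebraicGeometry.HodgeTheory.MiddleDimensionReductionProofs

/-!
# Route CurveNetMordellWeil, crux `VerticalSupportMiddle` (stmt-HodgeConjecture-2782): the crux AS TYPED is
# equivalent to the Hodge conjecture — unconditionally (helpers, `--supports`)

Line `regime-split-middle-step`. The two earlier leads proved the crux summit-sized MODULO Deligne descent,
the Stein-free transfer and the existence of curve nets (`…Characterisation`, p111410:
`verticalSupportMiddle_iff_of_transfer`). With the descent facts now DISCHARGED in the tree and the level-wise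
reduction of this line (`hodgeConjecture_of_middleStep`, `hodge_below_middle_of_hodgeBelowDim`), every side
hypothesis disappears:

* `verticalSupportMiddle_imp_middleStepFor` — **the crux implies the middle step of the Hodge conjecture on
  EVERY class of `2q`-folds** (in particular the heart `MiddleStepFor (¬ ChowZeroDegenerate ·)` is NECESSARY
  for the crux): for a rational `(q,q)`-class `c` on a `2q`-fold `X`, pass to the `(2q+1)`-fold `X × ℙ¹`
  (`mem_algebraicClasses_of_projectiveLine_of_preservesHodgeType`, the `ℙ¹`-step of BFNP Lemma 48, pull-backs
  only); there every rational `(q,q)`-class has coniveau `≥ 1` by the landed hardness theorem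
  `verticalSupportMiddle_coniveau_one_of_odd` (the crux applied to `X × ℙ¹ × ℙ¹ → ℙ^{2q+1}`), hence is
  algebraic by Deligne descent (`supportedHodgeClass_mem_algebraicClasses_of_codim_lt`, both descent facts
  `_holds`), whose inductive input in dimension `2q` is BELOW the middle and therefore supplied by the
  hypothesis `HodgeBelowDim (2q)` through the pencil step (`hodge_below_middle_of_hodgeBelowDim`).
* `verticalSupportMiddle_iff_middleStep` — **crux ⟺ the level-wise middle step** `MiddleStepFor (fun _ ↦ True)`.
* `verticalSupportMiddle_iff_hodgeConjecture` (registered sub-goal) — **crux ⟺ `HodgeConjecture`**: the item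
  as typed is EXACTLY summit-sized, with no side hypothesis left.

Consequences for the line: the regime split loses nothing (`verticalSupportMiddle_of_regimes` is an
equivalence up to the provable regime), and the heart is both necessary and — with the CH₀-degenerate regime,
proved granted a Gysin / cycle-class formalism — sufficient.

## References

* [BrosnanFangNiePearlstein2009] P. Brosnan, H. Fang, Z. Nie, G. Pearlstein, §6 Lemma 48 (the `ℙ¹`-step).
* [KerrPearlstein2011] M. Kerr, G. Pearlstein, §3.1.
* [DeligneHodgeIII1974] P. Deligne, Théorie de Hodge III, Cor. 8.2.8.
* [Voisin2025] C. Voisin, J. Open Math. Probl. 1 (2025), Cor. 2.12.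
-/

noncomputable section

-- `Summit.HodgeConjecture.HodgeConjecture.Theorems` is the mandated namespace (single-problem summit:
-- Problem = Summit), which `linter.dupNamespace` flags on every declaration; the lakefile turns the
-- linter off tree-wide (weak option), restated here so stand-alone elaboration is warning-free too.
set_option linter.dupNamespace false

open CategoryTheory AlgebraicGeometry MonoidalCategory CartesianMonoidalCategory
open Literature.AlgebraicGeometry Literature.AlgebraicGeometry.Motives
  Literature.AlgebraicGeometry.HodgeTheory Literature.AlgebraicTopology.SingularHomology
open Summit.HodgeConjecture.HodgeConjecture.Theses.CurveNetMordellWeil (VerticalSupportMiddle)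

namespace Summit.HodgeConjecture.HodgeConjecture.Theorems

open RegimeSplit

/-- **The crux implies the middle step of the Hodge conjecture on every class of `2q`-folds** (so the
heart is necessary for the crux): given `VerticalSupportMiddle`, `q ≥ 2`, a smooth projective `2q`-fold `X`
and the Hodge conjecture in all dimensions `< 2q`, every rational `(q,q)`-class `c` on `X` is algebraic —
by the `ℙ¹`-step (`mem_algebraicClasses_of_projectiveLine_of_preservesHodgeType`) it suffices to treat the
rational `(q,q)`-classes of the `(2q+1)`-fold `X × ℙ¹`, which have coniveau `≥ 1` by
`verticalSupportMiddle_coniveau_one_of_odd` and are therefore algebraic by Deligne descent, the descent's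
inductive input living below the middle (`hodge_below_middle_of_hodgeBelowDim`) or in dimension `< 2q`.
[cite: BrosnanFangNiePearlstein2009, §6 Lemma 48 (proof)] [cite: DeligneHodgeIII1974, Cor. 8.2.8]
[cite: Voisin2025, Cor. 2.12] -/
theorem verticalSupportMiddle_imp_middleStepFor (hMid : VerticalSupportMiddle) (P : ∀ _ : SchemeOver ℂ, Prop) :
    MiddleStepFor P := by
  intro q X hq hX ih _ c hc hh
  have hI : hodgePQ_independent_of_hodgeModel := hodgePQ_independent_of_hodgeModel_holds
  have hA : ∀ ⦃n : ℕ⦄ ⦃Y : Motives.SchemeOver ℂ⦄, nonempty_hodgeModel n Y := fun _ _ ↦ nonempty_hodgeModel_holds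
  have hP : IsSmoothProjective 1 (Motives.projectiveSpace 1 ℂ) := Motives.isSmoothProjective_projectiveSpace_holds ℂ 1
  have hXP : IsSmoothProjective (2 * q + 1) (X ⊗ Motives.projectiveSpace 1 ℂ) :=
    Motives.IsSmoothProjective.tensor_holds hX hP
  refine mem_algebraicClasses_of_projectiveLine_of_preservesHodgeType hX
    (preservesHodgeType_of_nonempty_hodgeModel hI (hA (Y := X ⊗ Motives.projectiveSpace 1 ℂ)) hXP hX
      (fst X (Motives.projectiveSpace 1 ℂ)))
    (fun κ hκ hκpp ↦ ?_) c hc hh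
  -- on the `(2q+1)`-fold `X × ℙ¹`, rational `(q,q)`-classes have coniveau `≥ 1` (hardness), hence are algebraic (descent)
  have hsupp : κ ∈ supportedClasses (X ⊗ Motives.projectiveSpace 1 ℂ) (2 * q) 1 :=
    verticalSupportMiddle_coniveau_one_of_odd hMid (p := q) (by omega) hXP κ hκ hκpp
  refine supportedHodgeClass_mem_algebraicClasses_of_codim_lt
    Deligne1974_ker_restrictCompl_eq_iSup_range_complexGysin_holds
    Voisin2025_hodgeClass_lift_complexGysin_holds hXP (fun m d Y hm hd hY β hβ hβ' ↦ ?_) κ hκ hκpp hsupp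
  -- the descent's inductive input: dimension `m ≤ 2q`, codimension `d = m - q - 1`
  rcases Nat.lt_or_ge m (2 * q) with hlt | hge
  · exact ih hlt hY d β hβ hβ'
  · obtain rfl : m = 2 * q := by omega
    exact hodge_below_middle_of_hodgeBelowDim ih hY d (by omega) β hβ hβ'

/-- **The crux is equivalent to the level-wise middle step of the Hodge conjecture**
(`MiddleStepFor (fun _ ↦ True)`: for all `q ≥ 2`, HC in dimensions `< 2q` ⟹ HC^q on `2q`-folds).
[cite: KerrPearlstein2011, §3.1] [cite: BrosnanFangNiePearlstein2009, §6 Lemma 48] -/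
theorem verticalSupportMiddle_iff_middleStep : VerticalSupportMiddle ↔ MiddleStepFor fun _ ↦ True :=
  ⟨fun h ↦ verticalSupportMiddle_imp_middleStepFor h _, verticalSupportMiddle_of_middleStep⟩

/-- **The crux `VerticalSupportMiddle` AS TYPED is equivalent to the Hodge conjecture — unconditionally**
(registered sub-goal of stmt-HodgeConjecture-2782): `→` by `verticalSupportMiddle_imp_middleStepFor` and the
level-wise reduction `hodgeConjecture_of_middleStep`; `←` by `verticalSupportMiddle_of_hodgeConjecture`. The item
is exactly summit-sized; every earlier "modulo descent / transfer / nets" qualification is gone.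
[cite: KerrPearlstein2011, §3.1] [cite: Deligne2000, §1] -/
theorem verticalSupportMiddle_iff_hodgeConjecture : VerticalSupportMiddle ↔ _root_.HodgeConjecture :=
  ⟨fun h ↦ hodgeConjecture_of_middleStep (verticalSupportMiddle_imp_middleStepFor h _),
    verticalSupportMiddle_of_hodgeConjecture⟩

/-- In particular the heart of the line (`MiddleStepFor (¬ ChowZeroDegenerate ·)`) is NECESSARY for the crux,
and the crux is equivalent to "heart ∧ CH₀-degenerate regime". [cite: VoisinHodgeII2003, Thm. 10.17 and Prop. 10.26] -/
theorem verticalSupportMiddle_iff_regimes :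
    VerticalSupportMiddle ↔
      (MiddleStepFor fun X ↦ ¬ ChowZeroDegenerate X) ∧ MiddleStepFor ChowZeroDegenerate :=
  ⟨fun h ↦ ⟨verticalSupportMiddle_imp_middleStepFor h _, verticalSupportMiddle_imp_middleStepFor h _⟩,
    fun h ↦ verticalSupportMiddle_of_regimes h.1 h.2⟩

end Summit.HodgeConjecture.HodgeConjecture.Theorems

end
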